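import Literature.IUT.HodgeArakelov.LabelClassesOfCuspsRmk231Proofs
import Literature.AnabelianGeometry.AbsoluteAnabelian.FreeProcyclicPowers

/-!
# [IUTchII] Rmk 2.3.1 with the `Ẑ(1)`-shape input discharged BY NAME from "`I ≅ Ẑ`"

S. Mochizuki, *Inter-universal Teichmüller theory II*, kurims manuscript (Dec. 2020), §2, Remark 2.3.1, p. 69
([IUTchII] Rmk 2.3.1, kurims p.69) [claim: Mochizuki2012, status: disputed] (D-0012 claim key; series status
DISPUTED — elementary group theory over the landed typings only; nothing of the series is asserted).  PROOF-ONLY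
junction (abc-iut cell; DAG node `IUTchII:Rmk2.3.1`; seat abc-iut-L6-t19 gen 5) of
`LabelClassesOfCuspsRmk231Proofs.lean` (abc-iut-L6-t19, p417290: `rmk231_powers_of_inputs`,
`isCuspidalInertia_map_conj_of_inputs`, both taking the "`Ẑ(1)`-shape" input as the inline hypothesis
`hZ : [I : I^l] = l`) with the classical brick `FreeProcyclicPowers.lean` (abc-iut-L6-t19 over abc-iut-L4-t6's
`FreeProcyclicStructure` / `ZHatCompletionFreeProcyclic`: `[Ẑ : Ẑ^n] = n`).  No definitions.

RESULT: in `rmk231_powers_of_inputs` / `isCuspidalInertia_map_conj_of_inputs` the hypothesis `hZ` is replaced by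
the tree's own spellings of "the cuspidal inertia group `I` is isomorphic to `Ẑ(1)`" ([SemiAnbd] §6 p. 71, as in
abc-iut-L3's `TemperedCurve.inertia_equiv_zHat`; [AbsTopIII] Prop. 1.4 (i) p. 31, as in abc-iut-L4's
`FundamentalExtension.IsFreeProcyclic` / `CuspidalData.InertiaFreeProcyclic`):

* `rmk231_powers_of_zHat`, `isCuspidalInertia_map_conj_of_zHat` — input "`Nonempty (I ≃ₜ* Ẑ)`" (Mathlib's
  profinite completion of `ℤ` = `SemiGraphs.ZHat` = `IUT.HodgeTheaters.ZHat`) for the cuspidal inertia groups of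
  `Π_⊇`, the ambient `Π̂^cor_v` Hausdorff;
* `rmk231_powers_of_isFreeProcyclic` — input "`I` compact and `IsFreeProcyclic I`".

Still inline (owners per plan/L6): `Π_⊆ ⊴ Π_⊇` of index `l`, total ramification at the cusps, `Π_⊇⊇`-invariance
of the cuspidal inertia groups of `Π_⊇`; and the IDENTIFICATION of abc-iut-L6-t1's abstract `IsCuspidalInertia`
with L3/L4/L5 inertia groups (an agreement of the B13 kind) is what will supply `Nonempty (I ≃ₜ* Ẑ)`.  Nothing here
takes a side on [IUTchIII] Cor. 3.12; typed ≠ discharged.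
-/

noncomputable section

open ProfiniteGrp ProfiniteGrp.ProfiniteCompletion

namespace Literature.IUT.HodgeArakelov

open Literature.AnabelianGeometry.AbsoluteAnabelian

universe u

variable {S : BadPlaceSetting.{u}} {P : TopGroup.{u}} {T : TemperedCoverings S P} {W : PlusMinusTower T}

/-- **IUTchII:Rmk2.3.1, first claim, `Ẑ(1)`-input by name** (kurims p. 69 "`I ∩ Π_⊆ = I^l`"): as
`rmk231_powers_of_inputs`, with "`[I : I^l] = l`" DISCHARGED from "`I ≅ Ẑ(1)`" in the form
`Nonempty (I ≃ₜ* Ẑ)` ([SemiAnbd] §6 p. 71; `Ẑ` = Mathlib's profinite completion of `ℤ`), the ambient `Π̂^cor_v`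
being Hausdorff.  PROVED (modulo the remaining named inputs). ([IUTchII] Rmk 2.3.1 p.69) [claim: Mochizuki2012, status: disputed] -/
theorem rmk231_powers_of_zHat [T2Space W.Corhat] (C : CuspidalInertiaData W) {Qsub Qsup : Subgroup W.Corhat}
    (hle : Qsub ≤ Qsup) (hN : (Qsub.subgroupOf Qsup).Normal) (hidx : Qsub.relIndex Qsup = S.l)
    (hZhat : ∀ I, C.IsCuspidalInertia Qsup I → Nonempty (I ≃ₜ* completion (GrpCat.of (Multiplicative ℤ))))
    (hram : ∀ I, C.IsCuspidalInertia Qsup I → ¬ I ≤ Qsub) :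
    Literature.IUT.HodgeArakelov.Rmk231_powers C Qsub Qsup :=
  rmk231_powers_of_inputs C hle hN hidx
    (fun I hI => (hZhat I hI).elim fun e =>
      relIndex_closure_pow_image_of_continuousMulEquiv_zHat I e S.l_prime.pos)
    hram

/-- **IUTchII:Rmk2.3.1, first claim, `Ẑ(1)`-input by name (intrinsic form)**: as `rmk231_powers_of_inputs`, with
"`[I : I^l] = l`" DISCHARGED from abc-iut-L4's intrinsic predicate — every cuspidal inertia group `I` of `Π_⊇` is
compact and `IsFreeProcyclic` in the subspace topology ([AbsTopIII] Prop. 1.4 (i) p. 31 "`I_x` … is naturally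
isomorphic to `Ẑ(1)`").  PROVED (modulo the remaining named inputs). ([IUTchII] Rmk 2.3.1 p.69) [claim: Mochizuki2012, status: disputed] -/
theorem rmk231_powers_of_isFreeProcyclic [T2Space W.Corhat] (C : CuspidalInertiaData W)
    {Qsub Qsup : Subgroup W.Corhat}
    (hle : Qsub ≤ Qsup) (hN : (Qsub.subgroupOf Qsup).Normal) (hidx : Qsub.relIndex Qsup = S.l)
    (hZfp : ∀ I, C.IsCuspidalInertia Qsup I →
      IsCompact (I : Set W.Corhat) ∧ FundamentalExtension.IsFreeProcyclic I)
    (hram : ∀ I, C.IsCuspidalInertia Qsup I → ¬ I ≤ Qsub) :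
    Literature.IUT.HodgeArakelov.Rmk231_powers C Qsub Qsup :=
  rmk231_powers_of_inputs C hle hN hidx
    (fun I hI => by
      haveI : CompactSpace I := isCompact_iff_compactSpace.mp (hZfp I hI).1
      exact (hZfp I hI).2.relIndex_closure_pow_image I S.l_prime.pos)
    hram

/-- **IUTchII:Rmk2.3.1, second claim, `Ẑ(1)`-input by name** (kurims p. 69 "the cuspidal inertia groups of `Π_v`
… are permuted by the conjugation action of `Π^cor_v`"): as `isCuspidalInertia_map_conj_of_inputs` (Def. 2.3 (ii)
statement of record `Def23_ii'`; `Π_⊆ ⊴ Π_⊇` of index `l`; total ramification; `Π_⊇⊇`-invariance of the cuspidal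
inertia groups of `Π_⊇`), with the `Ẑ(1)`-shape supplied as `Nonempty (I ≃ₜ* Ẑ)`.  PROVED (modulo the remaining
named inputs). ([IUTchII] Rmk 2.3.1 p.69) [claim: Mochizuki2012, status: disputed] -/
theorem isCuspidalInertia_map_conj_of_zHat [T2Space W.Corhat] (C : CuspidalInertiaData W)
    {Qsub Qsup Qss : Subgroup W.Corhat} (hDef : Literature.IUT.HodgeArakelov.Def23_ii' C Qsub Qsup)
    (hN : (Qsub.subgroupOf Qsup).Normal) (hidx : Qsub.relIndex Qsup = S.l)
    (hZhat : ∀ I, C.IsCuspidalInertia Qsup I → Nonempty (I ≃ₜ* completion (GrpCat.of (Multiplicative ℤ))))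
    (hram : ∀ I, C.IsCuspidalInertia Qsup I → ¬ I ≤ Qsub)
    (hsup : ∀ g ∈ Qss, ∀ I', C.IsCuspidalInertia Qsup I' →
      C.IsCuspidalInertia Qsup (I'.map (MulAut.conj g).toMonoidHom))
    {g : W.Corhat} (hg : g ∈ Qss) {J : Subgroup W.Corhat} (hJ : C.IsCuspidalInertia Qsub J) :
    C.IsCuspidalInertia Qsub (J.map (MulAut.conj g).toMonoidHom) :=
  isCuspidalInertia_map_conj_of_inputs C hDef hN hidx
    (fun I hI => (hZhat I hI).elim fun e =>
      relIndex_closure_pow_image_of_continuousMulEquiv_zHat I e S.l_prime.pos)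
    hram hsup hg hJ

end Literature.IUT.HodgeArakelov

end
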